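import Summits.NavierStokesRegularity.NavierStokesRegularity.Theses.TypeICertificateLadder
import Literature.Analysis.FluidPDE.VectorCalculus
import Literature.Analysis.FluidPDE.NSCriticalClosureBesovKatoClass
import Literature.Analysis.FluidPDE.DriftHeatLocalClass

/-!
# Line `reach-shielded-core-regularity` — crux `TypeIConcentration` (stmt-NavierStokesRegularity-2881)

Skeleton (crux-plan, round 1) for the idea card
`Cruxes/TypeIConcentration/Ideas/reach-shielded-core-regularity.md`, sharpened by the triage panel
(TRIAGE-r1-1/2/3: "rebuild the engine as vorticity-Duhamel / receding, depth-graded barrier;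
keep the statement"). Line card: `Lines/reach-shielded-core-regularity.md`.

THE LINE. A Type-I(`C`) singular point `x₀` is never VORTICITY-CALM at the similarity scale:
if at some late time `t₁` the scale-invariant vorticity `(T−t₁)|ω(t₁,x)|` were `≤ ε(C)` on the
ball `B(x₀, ρ(C)√(ν(T−t₁)))`, then

* `stub_vorticityShield` (the lever, hardest): the calm core is SHIELDED until `T` — on the fixed
  physical ball `B(x₀, √(ν(T−t₁)))` the vorticity stays SUB-critical,
  `|ω(s,y)| ≤ K (T−t₁)^{δ−1} (T−s)^{−δ}` with `δ < 1/4`, for all `s ∈ [t₁,T)`. Engine: `|ω|` is a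
  subsolution of the drift–diffusion operator `∂ₛ + u·∇ − νΔ` with reaction `|∇u|`; TRANSPORT IS
  KEPT IN THE OPERATOR (finite Lagrangian reach `∫‖u‖∞ ≤ 2C√(ν(T−s))` ⇒ the propagator has a
  drift-DISPLACED Gaussian tail, `stub_displacedTail`, so no smallness of `u` is ever needed —
  this is what the Oseen/heat-Duhamel engines of the sibling lines cannot do for the vorticity
  equation, whose transport term `u⊗ω` is linear in `ω` with an envelope-sized coefficient);
  "no action at a distance": the strain of far vorticity is the gradient of a field HARMONIC near
  the point, bounded through the velocity envelope by `3C√ν/(d√(T−s))` at depth `d`, and the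
  near strain is `≲ |ω| log` (bootstrap-small); the control region recedes POLYNOMIALLY,
  `R(s) = √(ν(T−t₁)) (1 + λ((T−s)/(T−t₁))^α)` (`α = δ/2`), so that the similarity gap to the
  uncontrolled Type-I vorticity GROWS like `((T−t₁)/(T−s))^{1/2−α}` and the exterior leak at the
  edge is `≲ C₁²(λα)^{-2}(T−t₁)^{2α−1}(T−s)^{−2α}` — subcritical with exponent `δ = 2α`
  (derivative bounds `C₁, C₂` under the envelope: `stub_derivBounds`);
* `stub_subcriticalVorticityBounded` (closing): subcritical vorticity on a ball + finite energy
  ⇒ `u` bounded on `B(x₀, √(ν(T−t₁))/4) × [t₁,T)` (local Biot–Savart with a remainder HARMONIC in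
  the ball, bounded by the ENERGY through the mean-value property — the one place `IsLerayHopfOn`
  is spent, exactly where `Disproof.typeIConcentration_false_without_LerayHopf` says it must be —
  then one heat/Oseen pass, convergent because `2δ < 1/2`);

so `(T, x₀)` would be a regular point, contradicting the singular point produced from
`¬ HasSmoothExtensionPast` by the tree theorem
`exists_singularPoint_of_classical_of_not_hasSmoothExtensionPast` (this is where
`Disproof.typeIConcentration_false_without_noExtension` is honoured). Hence at EVERY late `t`
some `x ∈ B(x₀, ρ√(ν(T−t)))` has `(T−t)|ω(t,x)| > ε`, and `stub_hotVorticityMass` (1-D Taylor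
along the direction of largest shear, using `C₁, C₂`) turns it into `L³` mass
`κ₁ ε¹² ν³/(C₁³C₂⁶)` on a similarity ball next to `x` — the crux, with `ρ_crux = ρ + κ₂(ε/C₂ +
ε²/(C₁C₂))`, `γ = κ₁ε¹²/(C₁³C₂⁶)` depending on `C` only, at EVERY singular point and for EVERY
late time (the TRANSFER `C⁺` of the card).

Every stub signature is written over tree / Mathlib declarations only (no local definition), so a
stub worker can restate it verbatim in a `Theorems/` file. The Type-I(`C`) ENVELOPE on a window
`[t₀, T)` is spelled `∀ s ∈ Ico t₀ T, ∀ x, √(T − s) * ‖u s x‖ ≤ C * √ν` throughout.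
`TypeIConcentration_of : TypeIConcentration` is the kernel-checked composition (no `sorry` outside
`stub_*`; its closure is the five stubs). Namespace: `…Cruxes.TypeIConcentration.ReachShieldedCoreRegularity`.
-/

noncomputable section

set_option linter.dupNamespace false

namespace Summit.NavierStokesRegularity.NavierStokesRegularity.Cruxes.TypeIConcentration.ReachShieldedCoreRegularity

open Set Filter Topology MeasureTheory Metric Function
open Literature.Analysis.FluidPDE
open Summit.NavierStokesRegularity.NavierStokesRegularity.Theses.TypeICertificateLadder

/-! ### Registered stubs -/

/-- **S1 · `stub_derivBounds` (M) — derivative bounds under the envelope, orders 1 and 2, constants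
depending on `C` only.** Under the envelope on `[t₀,T)`, after the parabolic lag `(t₀+T)/2`:
`(T−t)‖∇u(t,x)‖ ≤ C₁(C)` and `(T−t)√(ν(T−t)) ‖∇²u(t,x)‖ ≤ C₂(C)`. Route: KNSS 2009 Prop. 4.1
(`knss2009_local_smoothing_holds`, `k = 1, 2`, `l = 0`) on the window `[t − (T−t)/C², t]` with
datum bound `M = C√(2ν/(T−t))`, and identification of `u` with the bounded local mild solution
(`exists_oseen_fixedPoint_bounded` / `oseenMild_bounded_unique`, `OseenDuhamelEnvelopeRestart`,
`serrin_weak_strong_uniqueness_holds` — where `IsLerayHopfOn` enters). `C₁ = O(C² + C)`,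
`C₂ = O(C³ + C)`. Shared in substance with the sibling lines' `GradientUnderEnvelope`. -/
theorem stub_derivBounds :
    ∀ C : ℝ, 0 < C → ∃ C₁ : ℝ, 0 < C₁ ∧ ∃ C₂ : ℝ, 0 < C₂ ∧
      ∀ (ν T t₀ : ℝ), 0 < ν → 0 ≤ t₀ → t₀ < T →
      ∀ (u : ℝ → EuclideanSpace ℝ (Fin 3) → EuclideanSpace ℝ (Fin 3))
        (p : ℝ → EuclideanSpace ℝ (Fin 3) → ℝ),
        IsClassicalNSSolutionOn (Ico 0 T) ν 0 u p → IsLerayHopfOn T ν 0 (u 0) u →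
        HasRapidSpatialDecay (u 0) →
        (∀ s ∈ Ico t₀ T, ∀ x, Real.sqrt (T - s) * ‖u s x‖ ≤ C * Real.sqrt ν) →
        ∀ t ∈ Ioo ((t₀ + T) / 2) T, ∀ x : EuclideanSpace ℝ (Fin 3),
          (T - t) * ‖fderiv ℝ (u t) x‖ ≤ C₁ ∧
          (T - t) * Real.sqrt (ν * (T - t)) * ‖fderiv ℝ (fun y => fderiv ℝ (u t) y) x‖ ≤ C₂ := by
  sorry

/-- **S2 · `stub_displacedTail` (M) — the REACH lever as a linear PDE fact: drift-displaced
Gaussian tail for the drift–heat equation `θ_t + a·∇θ − Δθ = 0` with bounded drift `‖a‖ ≤ A`**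
(unit diffusion; the tree's elementary class `IsDriftHeatSolutionOn a θ A (Icc s t) univ`). If the
bounded solution `θ` vanishes at time `s` on `B(x₀, d)` and is `≤ M` in modulus elsewhere, then
`|θ(t,x₀)| ≤ 6M exp(−(d/√3 − A(t−s))₊² / (4(t−s)))`: information travels at most the REACH
`A(t−s)` plus a Gaussian. Proof: comparison (`IsDriftHeatSolutionOn.paraboloid_comparison` /
`driftHeat_comparison` on a large cylinder, using that `θ` is bounded and the class is closed
under `neg`) with the six planar barriers `M exp(α(±(x−x₀)ᵢ − d/√3) + αA(τ−s) + α²(τ−s))`,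
supersolutions for EVERY drift of size `≤ A` (no divergence-freeness needed), dominating the data
(a point outside `B(x₀,d)` has a coordinate of size `≥ d/√3`); optimise `α ≥ 0`; `M = 0` by a
limit. -/
theorem stub_displacedTail :
    ∀ (a : ℝ → EuclideanSpace ℝ (Fin 3) → EuclideanSpace ℝ (Fin 3))
      (θ : ℝ → EuclideanSpace ℝ (Fin 3) → ℝ) (A s t : ℝ), s < t →
      IsDriftHeatSolutionOn a θ A (Icc s t) univ →
      (∃ M₀ : ℝ, ∀ τ ∈ Icc s t, ∀ x, |θ τ x| ≤ M₀) →
      ∀ (x₀ : EuclideanSpace ℝ (Fin 3)) (d M : ℝ), 0 < d → 0 ≤ M →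
        (∀ y ∈ ball x₀ d, θ s y = 0) → (∀ y, |θ s y| ≤ M) →
        |θ t x₀| ≤ 6 * M *
          Real.exp (-(max (d / Real.sqrt 3 - A * (t - s)) 0) ^ 2 / (4 * (t - s))) := by
  sorry

/-- **S3 · `stub_vorticityShield` (XL, hardest, load-bearing) — the VORTICITY SHIELD, from S1 and
S2** (the two antecedents are verbatim the statements of `stub_derivBounds` and
`stub_displacedTail`, so this stub's prover may use them; `TypeIConcentration_of` discharges
them). For every `C` there are `ε, ρ > 0`, an exponent `0 < δ < 1/4` and `K > 0` (all depending
on `C` only) such that, under the envelope on `[t₀,T)` and for calm times `t₁ > (t₀+T)/2` (so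
that S1's bounds hold on `[t₁,T)`, the calm time included): if `(T−t₁)|curl u(t₁,x)| ≤ ε` on `B(x₀, ρ√(ν(T−t₁)))`, then
on the FIXED physical ball `B(x₀, √(ν(T−t₁)))` the vorticity is SUBCRITICAL until `T`:
`|curl u(s,y)| ≤ K (T−t₁)^{δ−1} (T−s)^{−δ}`, `s ∈ [t₁,T)`. Intended proof: touching-point
bootstrap for `W(s) = K(T−t₁)^{δ−1}(T−s)^{−δ}` on the polynomially receding region
`B(x₀, √(ν(T−t₁))(1 + λ((T−s)/(T−t₁))^{δ/2}))`; `|ω|` (regularised) is a Kato subsolution of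
`∂ₛ + u·∇ − νΔ − ‖∇u‖`; strain at depth `d` inside the region split into the harmonic far part
`≤ 3C√ν/(d√(T−s)) + 3c₀W` (velocity envelope, "no action at a distance") and the near part
`≤ c W log(C₂/(W(T−s)^{3/2}√ν))` (CZ with the `∇ω` bound of S1), capped by `C₁/(T−s)` in the
edge layer; data, edge-layer and exterior leaks enter through the displaced tail of S2 (whole-space
comparison, transport exact); constants `λδ ≳ C₁(C)/√K + C log(λδ)`, `ε ≤ K/4`,
`K log(C₂/K) ≪ 1 − 2δ`, `ρ = 1 + λ + √3(2C + 2√(log(6C₁/ε)))`. -/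
theorem stub_vorticityShield :
    (∀ C : ℝ, 0 < C → ∃ C₁ : ℝ, 0 < C₁ ∧ ∃ C₂ : ℝ, 0 < C₂ ∧
      ∀ (ν T t₀ : ℝ), 0 < ν → 0 ≤ t₀ → t₀ < T →
      ∀ (u : ℝ → EuclideanSpace ℝ (Fin 3) → EuclideanSpace ℝ (Fin 3))
        (p : ℝ → EuclideanSpace ℝ (Fin 3) → ℝ),
        IsClassicalNSSolutionOn (Ico 0 T) ν 0 u p → IsLerayHopfOn T ν 0 (u 0) u →
        HasRapidSpatialDecay (u 0) →
        (∀ s ∈ Ico t₀ T, ∀ x, Real.sqrt (T - s) * ‖u s x‖ ≤ C * Real.sqrt ν) →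
        ∀ t ∈ Ioo ((t₀ + T) / 2) T, ∀ x : EuclideanSpace ℝ (Fin 3),
          (T - t) * ‖fderiv ℝ (u t) x‖ ≤ C₁ ∧
          (T - t) * Real.sqrt (ν * (T - t)) * ‖fderiv ℝ (fun y => fderiv ℝ (u t) y) x‖ ≤ C₂) →
    (∀ (a : ℝ → EuclideanSpace ℝ (Fin 3) → EuclideanSpace ℝ (Fin 3))
      (θ : ℝ → EuclideanSpace ℝ (Fin 3) → ℝ) (A s t : ℝ), s < t →
      IsDriftHeatSolutionOn a θ A (Icc s t) univ →
      (∃ M₀ : ℝ, ∀ τ ∈ Icc s t, ∀ x, |θ τ x| ≤ M₀) →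
      ∀ (x₀ : EuclideanSpace ℝ (Fin 3)) (d M : ℝ), 0 < d → 0 ≤ M →
        (∀ y ∈ ball x₀ d, θ s y = 0) → (∀ y, |θ s y| ≤ M) →
        |θ t x₀| ≤ 6 * M *
          Real.exp (-(max (d / Real.sqrt 3 - A * (t - s)) 0) ^ 2 / (4 * (t - s)))) →
    ∀ C : ℝ, 0 < C → ∃ ε : ℝ, 0 < ε ∧ ∃ ρ : ℝ, 0 < ρ ∧ ∃ δ : ℝ, 0 < δ ∧ δ < 1 / 4 ∧
      ∃ K : ℝ, 0 < K ∧
      ∀ (ν T t₀ : ℝ), 0 < ν → 0 ≤ t₀ → t₀ < T →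
      ∀ (u : ℝ → EuclideanSpace ℝ (Fin 3) → EuclideanSpace ℝ (Fin 3))
        (p : ℝ → EuclideanSpace ℝ (Fin 3) → ℝ),
        IsClassicalNSSolutionOn (Ico 0 T) ν 0 u p → IsLerayHopfOn T ν 0 (u 0) u →
        HasRapidSpatialDecay (u 0) →
        (∀ s ∈ Ico t₀ T, ∀ x, Real.sqrt (T - s) * ‖u s x‖ ≤ C * Real.sqrt ν) →
        ∀ t₁ ∈ Ioo ((t₀ + T) / 2) T, ∀ x₀ : EuclideanSpace ℝ (Fin 3),
          (∀ x ∈ ball x₀ (ρ * Real.sqrt (ν * (T - t₁))), (T - t₁) * ‖curl (u t₁) x‖ ≤ ε) →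
          ∀ s ∈ Ico t₁ T, ∀ y ∈ ball x₀ (Real.sqrt (ν * (T - t₁))),
            ‖curl (u s) y‖ ≤ K * (T - t₁) ^ (δ - 1) * (T - s) ^ (-δ) := by
  sorry

/-- **S4 · `stub_subcriticalVorticityBounded` (L) — closing: SUBCRITICAL VORTICITY ⇒ BOUNDED
VELOCITY near `(T, x₀)`.** Under the envelope on `[t₁,T)`, a classical Leray–Hopf solution whose
vorticity obeys `|curl u(s,y)| ≤ K (T−t₁)^{δ−1}(T−s)^{−δ}` (`δ < 1/4`) on
`B(x₀, √(ν(T−t₁))) × [t₁,T)` is BOUNDED on `B(x₀, √(ν(T−t₁))/4) × [t₁,T)` (a solution-dependent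
bound — all that "regular point" needs). Route: on `B = B(x₀, r₁)`, `u(s) = BS(ω(s)1_B) + h(s)`
with `h(s)` harmonic in `B` (`LocalBiotSavart*`, `BiotSavart*`), `|BS(ω1_B)| ≤ c r₁ K_s`,
`‖h(s)‖_{L²(B)} ≤ ‖u(s)‖₂ + c r₁^{5/2} K_s` with `‖u(s)‖₂ ≤ ‖u 0‖₂` (ENERGY, `IsLerayHopfOn`), mean
value ⇒ `|u(s,y)| ≤ M₁ + M₂(T−s)^{−δ}` on `B(x₀, r₁/2)`; then one localised heat-Duhamel pass for
`φω` (source `curl(u × ω) − 2ν∇φ·∇ω − νΔφ ω`, `|u||ω| ≲ (T−σ)^{−2δ}`,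
`∫(s−σ)^{−1/2}(T−σ)^{−2δ}dσ < ∞` uniformly iff `2δ < 1/2`) bounds `ω` on `B(x₀, r₁/3)`, and
Biot–Savart again bounds `u` on `B(x₀, r₁/4)`. (Velocity-side alternative: the Oseen pass
`QuietImpliesBounded` of the sibling card `quiet-point-subcritical-upgrade`.) -/
theorem stub_subcriticalVorticityBounded :
    ∀ (δ K C : ℝ), 0 < δ → δ < 1 / 4 → 0 < K → 0 < C →
      ∀ (ν T t₁ : ℝ), 0 < ν → 0 ≤ t₁ → t₁ < T →
      ∀ (u : ℝ → EuclideanSpace ℝ (Fin 3) → EuclideanSpace ℝ (Fin 3))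
        (p : ℝ → EuclideanSpace ℝ (Fin 3) → ℝ),
        IsClassicalNSSolutionOn (Ico 0 T) ν 0 u p → IsLerayHopfOn T ν 0 (u 0) u →
        HasRapidSpatialDecay (u 0) →
        (∀ s ∈ Ico t₁ T, ∀ x, Real.sqrt (T - s) * ‖u s x‖ ≤ C * Real.sqrt ν) →
        ∀ x₀ : EuclideanSpace ℝ (Fin 3),
          (∀ s ∈ Ico t₁ T, ∀ y ∈ ball x₀ (Real.sqrt (ν * (T - t₁))),
              ‖curl (u s) y‖ ≤ K * (T - t₁) ^ (δ - 1) * (T - s) ^ (-δ)) →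
          ∃ M : ℝ, ∀ s ∈ Ico t₁ T, ∀ y ∈ ball x₀ (Real.sqrt (ν * (T - t₁)) / 4),
            ‖u s y‖ ≤ M := by
  sorry

/-- **S5 · `stub_hotVorticityMass` (M) — conversion: a HOT VORTICITY VALUE GIVES `L³` MASS**
(pure calculus on one `C²` slice, in similarity units so that it plugs into S1). If
`(T−t)‖∇v‖ ≤ C₁` and `(T−t)√(ν(T−t))‖∇²v‖ ≤ C₂` everywhere and `(T−t)‖curl v(x)‖ ≥ ε`, then
`κ₁ ε¹² ν³/(C₁³C₂⁶) ≤ ∫_{B(x, κ₂(ε/C₂ + ε²/(C₁C₂))√(ν(T−t)))} ‖v‖³` for absolute `κ₁, κ₂ > 0`.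
Proof: `‖curl v(x)‖ ≤ ‖curlCLM‖ ‖Dv(x)‖` (`norm_curl_le`, `norm_curlCLM_le_four`) gives a unit `e`
with `‖Dv(x)e‖ ≳ ε/(T−t)`; Taylor along `s ↦ v(x+se)` with the `∇²` bound gives a point `z` at
distance `≍ ε√(ν(T−t))/C₂` with `‖v(z)‖ ≳ ε²√ν/(C₂√(T−t))`; the `∇` bound keeps
`‖v‖ ≥ ‖v(z)‖/2` on a ball of radius `≍ ε²√(ν(T−t))/(C₁C₂)`; integrate (`volume_ball`). -/
theorem stub_hotVorticityMass :
    ∃ κ₁ : ℝ, 0 < κ₁ ∧ ∃ κ₂ : ℝ, 0 < κ₂ ∧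
      ∀ (ε C₁ C₂ ν T t : ℝ), 0 < ε → 0 < C₁ → 0 < C₂ → 0 < ν → t < T →
      ∀ v : EuclideanSpace ℝ (Fin 3) → EuclideanSpace ℝ (Fin 3), ContDiff ℝ 2 v →
        (∀ y, (T - t) * ‖fderiv ℝ v y‖ ≤ C₁) →
        (∀ y, (T - t) * Real.sqrt (ν * (T - t)) * ‖fderiv ℝ (fun z => fderiv ℝ v z) y‖ ≤ C₂) →
        ∀ x : EuclideanSpace ℝ (Fin 3), ε ≤ (T - t) * ‖curl v x‖ →
          κ₁ * (ε ^ 12 / (C₁ ^ 3 * C₂ ^ 6)) * ν ^ 3 ≤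
            ∫ y in ball x (κ₂ * (ε / C₂ + ε ^ 2 / (C₁ * C₂)) * Real.sqrt (ν * (T - t))),
              ‖v y‖ ^ 3 := by
  sorry

/-! ### The kernel-checked composition -/

/-- **The line concludes the crux BY NAME** (closure = the five stubs; no other `sorry`, no
axiom). Constants `ρ_crux = ρ + κ₂(ε/C₂ + ε²/(C₁C₂))`, `γ = κ₁ε¹²/(C₁³C₂⁶)`; the envelope
window `[t₀,T)`, `t₀ ≥ 0`, is read off the eventual rate; the centre is the singular point of
`exists_singularPoint_of_classical_of_not_hasSmoothExtensionPast`; for every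
`t ∈ ((t₀+T)/2, T)`: were the vorticity `ε`-calm on `B(x₀, ρ√(ν(T−t)))`, S3 (fed by S1, S2) and
S4 would bound `u` on `B(x₀, √(ν(T−t))/4) × [t,T)`, which contains a backward parabolic cylinder
at `(T,x₀)` — contradicting singularity; so a hot value exists there, S1 gives the derivative
bounds at time `t`, S5 the mass on a ball inside `B(x₀, ρ_crux√(ν(T−t)))`, and monotonicity of
the set integral finishes. -/
theorem TypeIConcentration_of : TypeIConcentration := by
  intro C hC
  obtain ⟨C₁, hC₁, C₂, hC₂, hD⟩ := stub_derivBounds C hC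
  obtain ⟨ε, hε, ρ, hρ, δ, hδ, hδ4, K, hK, hS⟩ :=
    stub_vorticityShield stub_derivBounds stub_displacedTail C hC
  obtain ⟨κ₁, hκ₁, κ₂, hκ₂, hM⟩ := stub_hotVorticityMass
  set ρ' : ℝ := ρ + κ₂ * (ε / C₂ + ε ^ 2 / (C₁ * C₂)) with hρ'
  set γ : ℝ := κ₁ * (ε ^ 12 / (C₁ ^ 3 * C₂ ^ 6)) with hγ
  have hκpos : 0 < κ₂ * (ε / C₂ + ε ^ 2 / (C₁ * C₂)) := by positivity
  refine ⟨ρ', by positivity, γ, by positivity, ?_⟩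
  intro ν T hν hT u p hcl hLH hdec hrate hext
  -- the singular point `(T, x₀)`
  obtain ⟨x₀, hx₀⟩ :=
    exists_singularPoint_of_classical_of_not_hasSmoothExtensionPast hν hT hcl hLH hdec hext
  refine ⟨x₀, ?_⟩
  -- the envelope window `[t₀, T)`, `0 ≤ t₀`
  obtain ⟨t', ht'T, ht'⟩ := mem_nhdsLT_iff_exists_Ioo_subset.1 hrate
  have ht'T' : t' < T := ht'T
  set t₀ : ℝ := max ((t' + T) / 2) 0 with ht₀def
  have ht₀T : t₀ < T := max_lt (by linarith) hT
  have ht₀0 : 0 ≤ t₀ := le_max_right _ _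
  have ht't₀ : t' < t₀ := lt_of_lt_of_le (by linarith) (le_max_left _ _)
  have henv : ∀ s ∈ Ico t₀ T, ∀ x, Real.sqrt (T - s) * ‖u s x‖ ≤ C * Real.sqrt ν :=
    fun s hs x => ht' ⟨ht't₀.trans_le hs.1, hs.2⟩ x
  -- the conclusion holds for every `t ∈ ((t₀ + T)/2, T)`
  have hev : Ioo ((t₀ + T) / 2) T ∈ 𝓝[<] T := Ioo_mem_nhdsLT (by linarith)
  filter_upwards [hev] with t ht
  have ht0 : 0 < t := by linarith [ht.1]
  have htT : t < T := ht.2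
  have hTt : 0 < T - t := sub_pos.2 htT
  have hνT : 0 < ν * (T - t) := mul_pos hν hTt
  have ht₀t : t₀ ≤ t := by linarith [ht.1]
  have henvt : ∀ s ∈ Ico t T, ∀ x, Real.sqrt (T - s) * ‖u s x‖ ≤ C * Real.sqrt ν :=
    fun s hs x => henv s ⟨ht₀t.trans hs.1, hs.2⟩ x
  -- Step A: at time `t` some point of `B(x₀, ρ√(ν(T−t)))` carries a hot vorticity value
  have hhot : ∃ x ∈ ball x₀ (ρ * Real.sqrt (ν * (T - t))), ε < (T - t) * ‖curl (u t) x‖ := by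
    by_contra hcalm
    push Not at hcalm
    -- calm ⇒ shielded (S3) ⇒ bounded near `(T, x₀)` (S4)
    have hsh := hS ν T t₀ hν ht₀0 ht₀T u p hcl hLH hdec henv t ht x₀ hcalm
    obtain ⟨M, hMb⟩ := stub_subcriticalVorticityBounded δ K C hδ hδ4 hK hC ν T t hν ht0.le htT
      u p hcl hLH hdec henvt x₀ hsh
    -- a backward parabolic cylinder at `(T, x₀)` inside the bounded region
    set r : ℝ := min (Real.sqrt (ν * (T - t)) / 4) (Real.sqrt (T - t)) with hrdef
    have hrpos : 0 < r := lt_min (by positivity) (Real.sqrt_pos.2 hTt)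
    have hr1 : r ≤ Real.sqrt (ν * (T - t)) / 4 := min_le_left _ _
    have hr2 : r ≤ Real.sqrt (T - t) := min_le_right _ _
    have hr2' : r ^ 2 ≤ T - t := by
      calc r ^ 2 ≤ Real.sqrt (T - t) ^ 2 := pow_le_pow_left₀ hrpos.le hr2 2
        _ = T - t := Real.sq_sqrt hTt.le
    have hrT : r ^ 2 < T := by linarith
    have hfin : eLpNorm (uncurry u) ⊤
        (volume.restrict (parabolicCylinder r ((T : ℝ), x₀))) < ⊤ := by
      rw [eLpNorm_exponent_top]
      refine eLpNormEssSup_lt_top_of_ae_bound (C := M) ?_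
      filter_upwards [ae_restrict_mem (isOpen_parabolicCylinder r ((T : ℝ), x₀)).measurableSet]
        with z hz
      rw [mem_parabolicCylinder] at hz
      have hz1 : z.1 ∈ Ico t T := ⟨by linarith [hz.1.1], hz.1.2⟩
      have hz2 : z.2 ∈ ball x₀ (Real.sqrt (ν * (T - t)) / 4) :=
        mem_ball.2 (lt_of_lt_of_le hz.2 hr1)
      exact hMb z.1 hz1 z.2 hz2
    exact hfin.ne (hx₀ r hrpos hrT)
  obtain ⟨x, hx, hxhot⟩ := hhot
  -- Step B: derivative bounds at time `t` (S1) and the mass of the hot value (S5)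
  have hDt := hD ν T t₀ hν ht₀0 ht₀T u p hcl hLH hdec henv t ht
  have hv2 : ContDiff ℝ 2 (u t) := (hcl.contDiff_velocity ⟨ht0.le, htT⟩).of_le (by norm_cast)
  have hmass := hM ε C₁ C₂ ν T t hε hC₁ hC₂ hν htT (u t) hv2 (fun y => (hDt y).1)
    (fun y => (hDt y).2) x hxhot.le
  -- Step C: the small ball sits inside `B(x₀, ρ' √(ν(T−t)))`
  have hsub : ball x (κ₂ * (ε / C₂ + ε ^ 2 / (C₁ * C₂)) * Real.sqrt (ν * (T - t))) ⊆
      ball x₀ (ρ' * Real.sqrt (ν * (T - t))) := by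
    apply ball_subset_ball'
    have hxd : dist x x₀ < ρ * Real.sqrt (ν * (T - t)) := mem_ball.1 hx
    have : ρ' * Real.sqrt (ν * (T - t)) =
        κ₂ * (ε / C₂ + ε ^ 2 / (C₁ * C₂)) * Real.sqrt (ν * (T - t)) +
          ρ * Real.sqrt (ν * (T - t)) := by rw [hρ']; ring
    rw [this]
    linarith
  have hcont : Continuous (u t) := (hcl.contDiff_velocity ⟨ht0.le, htT⟩).continuous
  have hint : IntegrableOn (fun y => ‖u t y‖ ^ 3) (ball x₀ (ρ' * Real.sqrt (ν * (T - t)))) volume :=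
    (((hcont.norm.pow 3).continuousOn).integrableOn_compact (isCompact_closedBall _ _)).mono_set
      ball_subset_closedBall
  calc γ * ν ^ 3 = κ₁ * (ε ^ 12 / (C₁ ^ 3 * C₂ ^ 6)) * ν ^ 3 := by rw [hγ]
    _ ≤ ∫ y in ball x (κ₂ * (ε / C₂ + ε ^ 2 / (C₁ * C₂)) * Real.sqrt (ν * (T - t))), ‖u t y‖ ^ 3 :=
        hmass
    _ ≤ ∫ y in ball x₀ (ρ' * Real.sqrt (ν * (T - t))), ‖u t y‖ ^ 3 :=
        setIntegral_mono_set hint (ae_of_all _ fun _ => by positivity) hsub.eventuallyLE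

/-- Shape check: the composition is literally of the route decl's type. -/
example : Summit.NavierStokesRegularity.NavierStokesRegularity.Theses.TypeICertificateLadder.TypeIConcentration :=
  TypeIConcentration_of

end Summit.NavierStokesRegularity.NavierStokesRegularity.Cruxes.TypeIConcentration.ReachShieldedCoreRegularity

end
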